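import Summits.BirchSwinnertonDyer.BirchSwinnertonDyer.Theorems.ResidualThetaTransportAtTwoThetaLayerLambdaCongruenceAtTwoParabolicCharacterFactor
import HarnessLib

/-!
# The integral torsion lemma for Manin-symbol systems in an ARBITRARY additive group, and the `τ`-fixed cosets
# (towards Knapp's Prop. 11.22 — crux MS `TprimeIrrModThreeSaturation`, stmt-BirchSwinnertonDyer-23367, line
# `abelian-fixed-points`, lead g3; helper 1 of 3, `--supports` the crux)

The landed `ℓ = 2`-programme files `…ThetaLayerLambdaCongruenceAtTwoManinSymbolTorsion` / `…ParabolicCharacterFactor` prove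
that a character of `Γ₀(N)` killing cusp stabilisers and order-`4` elliptic elements factors through the period lattice —
for coefficient groups `R` WITHOUT `3`-TORSION.  The hypothesis enters in exactly two places; this file removes both:
* §1 `sum_smul_eq_zero_of_tau_invariant` + `sum_smul_eq_zero_of_mul_eq_relation'`: the abstract torsion lemma (finite `X`,
  `S² = 1`, `τ³ = 1`, Manin system `M` with (i)–(iv), `m·c = A + B + C` ⇒ `Σ c·M = 0`) with the step «`Σ B''·M = 0` by
  `3Σ = 0`» replaced by a `τ`-ORBIT DECOMPOSITION (free orbits contribute `B(x)(M x + M τx + M τ²x) = 0`, fixed points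
  `M = 0`) — valid in any `R`;
* §2 `maninSymbol_eq_neg_maninCusp_of_tauFixed`: on a `τ`-fixed coset (`γ g = g·ST⁻¹`, `γ ∈ Γ₀(N)` elliptic of order `3`
  in `PSL₂`) the Manin symbol of a symbol function `Φ` is MINUS THE ELLIPTIC PERIOD `Φ(γ·∞)` (the `τ`-analogue of the landed
  `maninSymbol_eq_neg_maninCusp_of_sigmaFixed`), so it vanishes as soon as the character kills `γ` — instead of `3[g] = 0`.
THEOREMS ONLY (combinatorics / `2 × 2` integer matrices); no definition, no named fact, no `sorry`; nothing about any curve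
is asserted; BSD is NOT proved by any of this.

References: [Manin1972] Thm. 1.9; Wiese, Computational arithmetic of modular forms, Thm. 5.7; [CremonaAlgorithms1997] §2.2.
-/

set_option autoImplicit false

-- D-0017: single-problem summit, so `Summit.BirchSwinnertonDyer.BirchSwinnertonDyer.…` repeats a namespace BY DESIGN.
set_option linter.dupNamespace false

noncomputable section

open scoped Classical MatrixGroups

open CongruenceSubgroup Matrix.SpecialLinearGroup ModularGroup
open Literature.NumberTheory.EllipticCurves.ModularForms
open Summit.BirchSwinnertonDyer.BirchSwinnertonDyer.Theorems.ThetaLayerLambdaCongruenceAtTwo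

namespace Summit.BirchSwinnertonDyer.BirchSwinnertonDyer.Theorems.TameQuarticManinParity

/-! ## §1. The integral torsion lemma without the `3`-torsion hypothesis -/

section Torsion

variable {X : Type*} [Fintype X] [DecidableEq X] {R : Type*} [AddCommGroup R]

/-- **`τ`-orbit decomposition.** For `τ` with `τ³ = 1` on a finite set, a `τ`-invariant integer weight `B` and an
`R`-valued `M` with `M(x) + M(τx) + M(τ²x) = 0` and `M = 0` on the fixed points of `τ`: `Σ_x B(x)·M(x) = 0` — in ANY
additive group `R` (sum over the `τ`-orbits: a free orbit contributes `B(x)(M(x) + M(τx) + M(τ²x)) = 0`, a fixed point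
`B(x)·0`). [folklore] -/
theorem sum_smul_eq_zero_of_tau_invariant (τ : X → X) (hτ : ∀ x, τ (τ (τ x)) = x) (M : X → R)
    (hM₂ : ∀ x, M x + M (τ x) + M (τ (τ x)) = 0) (hM₄ : ∀ x, τ x = x → M x = 0)
    (B : X → ℤ) (hB : ∀ x, B (τ x) = B x) : ∑ x, B x • M x = 0 := by
  -- the orbit relation of `τ`
  let r : X → X → Prop := fun a b ↦ b = a ∨ b = τ a ∨ b = τ (τ a)
  have r_refl : ∀ a, r a a := fun a ↦ Or.inl rfl
  have r_symm : ∀ {a b}, r a b → r b a := by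
    intro a b h
    rcases h with rfl | rfl | rfl
    · exact Or.inl rfl
    · exact Or.inr (Or.inr (by rw [hτ]))
    · exact Or.inr (Or.inl (by rw [hτ]))
  have r_trans : ∀ {a b c}, r a b → r b c → r a c := by
    intro a b c h1 h2
    rcases h1 with rfl | rfl | rfl
    · exact h2
    · rcases h2 with rfl | rfl | rfl
      · exact Or.inr (Or.inl rfl)
      · exact Or.inr (Or.inr rfl)
      · exact Or.inl (by rw [hτ])
    · rcases h2 with rfl | rfl | rfl
      · exact Or.inr (Or.inr rfl)
      · exact Or.inl (by rw [hτ])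
      · exact Or.inr (Or.inl (by rw [hτ]))
  let s : Setoid X := ⟨r, ⟨r_refl, fun h ↦ r_symm h, fun h1 h2 ↦ r_trans h1 h2⟩⟩
  refine Finset.sum_cancels_of_partition_cancels s fun x _ ↦ ?_
  -- the class of `x` is `{x, τx, τ²x}`
  have hcl : (Finset.univ.filter fun a ↦ s a x) = {x, τ x, τ (τ x)} := by
    ext a
    simp only [Finset.mem_filter, Finset.mem_univ, true_and, Finset.mem_insert, Finset.mem_singleton]
    change r a x ↔ _
    constructor
    · intro h
      rcases h with h | h | h
      · exact Or.inl h.symm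
      · exact Or.inr (Or.inr (by rw [h, hτ]))
      · exact Or.inr (Or.inl (by rw [h, hτ]))
    · intro h
      rcases h with rfl | rfl | rfl
      · exact Or.inl rfl
      · exact Or.inr (Or.inr (by rw [hτ]))
      · exact Or.inr (Or.inl (by rw [hτ]))
  rw [hcl]
  by_cases hx : τ x = x
  · have h2 : τ (τ x) = x := by rw [hx, hx]
    have hset : ({x, τ x, τ (τ x)} : Finset X) = {x} := by
      rw [h2, hx]; simp
    rw [hset, Finset.sum_singleton, hM₄ x hx, smul_zero]
  · have h1 : x ≠ τ x := fun h ↦ hx h.symm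
    have h2 : x ≠ τ (τ x) := by
      intro h
      have e : τ x = τ (τ (τ x)) := congrArg τ h
      rw [hτ] at e
      exact hx e
    have h3 : τ x ≠ τ (τ x) := by
      intro h
      have e : τ (τ (τ x)) = τ (τ (τ (τ x))) := congrArg (fun y ↦ τ (τ y)) h
      rw [hτ x] at e
      exact hx e.symm
    rw [Finset.sum_insert (by simp [h1, h2]), Finset.sum_insert (by simp [h3]), Finset.sum_singleton, hB (τ x),
      hB x, ← smul_add, ← smul_add, ← add_assoc, hM₂ x, smul_zero]

/-- **The integral torsion lemma for Manin-symbol systems in an ARBITRARY additive group** — the landed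
`sum_smul_eq_zero_of_mul_eq_relation` (crux `ThetaLayerLambdaCongruenceAtTwo`, brick B1) with its hypothesis
«`R` has no `3`-torsion» removed.  `X` finite with `S² = 1`, `τ³ = 1`; `M : X → R` with (i) `M(Sx) = −M(x)`, (ii)
`M(x) + M(τx) + M(τ²x) = 0`, (iii) `M = 0` on `S`-fixed points, (iv) `M = 0` on `τ`-fixed points; if `m·c = A + B + C`
(`m ≠ 0`, `A∘S = A`, `B∘τ = B`, `C` supported on fixed points) then `Σ_x c(x)·M(x) = 0`.  Proof verbatim from the
landed one (classes of the equivalence generated by `τ` and the good `S`-edges, `B'' = (B − B∘rep)/m`), except that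
`Σ B''·M = 0` is now the `τ`-orbit decomposition `sum_smul_eq_zero_of_tau_invariant` instead of `3Σ = 0`.
[cite: Manin1972, Thm. 1.9] -/
theorem sum_smul_eq_zero_of_mul_eq_relation' (S τ : X → X) (hS : ∀ x, S (S x) = x) (hτ : ∀ x, τ (τ (τ x)) = x)
    (M : X → R) (hM₁ : ∀ x, M (S x) = -M x) (hM₂ : ∀ x, M x + M (τ x) + M (τ (τ x)) = 0)
    (hM₃ : ∀ x, S x = x → M x = 0) (hM₄ : ∀ x, τ x = x → M x = 0)
    (c A B C : X → ℤ) (m : ℤ) (hm : m ≠ 0)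
    (hA : ∀ x, A (S x) = A x) (hB : ∀ x, B (τ x) = B x) (hC : ∀ x, C x ≠ 0 → S x = x ∨ τ x = x)
    (hrel : ∀ x, m * c x = A x + B x + C x) :
    ∑ x, c x • M x = 0 := by
  -- the equivalence relation generated by `x ~ τx` and the good `S`-edges `x ~ Sx`
  let good : X → Prop := fun x ↦ S x ≠ x ∧ τ x ≠ x ∧ τ (S x) ≠ S x
  let Rel : X → X → Prop := fun x y ↦ y = τ x ∨ (good x ∧ y = S x)
  let s : Setoid X := Relation.EqvGen.setoid Rel
  -- `B` is constant modulo `m` on the classes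
  have hBmod : ∀ x y, Relation.EqvGen Rel x y → m ∣ B x - B y := by
    intro x y h
    induction h with
    | rel a b hab =>
      rcases hab with rfl | ⟨⟨g1, g2, g3⟩, rfl⟩
      · exact ⟨0, by rw [hB, sub_self, mul_zero]⟩
      · exact int_dvd_sub_of_good_edge S τ hS c A B C m hA hC hrel g1 g2 g3
    | refl a => exact ⟨0, by rw [sub_self, mul_zero]⟩
    | symm a b _ ih => rw [← neg_sub]; exact (dvd_neg).mpr ih
    | trans a b d _ _ ih1 ih2 =>
      have : B a - B d = (B a - B b) + (B b - B d) := by ring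
      rw [this]; exact dvd_add ih1 ih2
  -- class representatives
  let rep : X → X := fun x ↦ (Quotient.mk s x).out
  have hrep : ∀ x, Relation.EqvGen Rel x (rep x) := fun x ↦
    Quotient.exact (s := s) (by rw [Quotient.out_eq])
  have hrep_τ : ∀ x, rep (τ x) = rep x := by
    intro x
    have : (Quotient.mk s (τ x)) = Quotient.mk s x :=
      (Quotient.sound (s := s) (Relation.EqvGen.rel x (τ x) (Or.inl rfl))).symm
    simp only [rep, this]
  have hrep_S : ∀ x, good x → rep (S x) = rep x := by
    intro x hx
    have : (Quotient.mk s (S x)) = Quotient.mk s x :=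
      (Quotient.sound (s := s) (Relation.EqvGen.rel x (S x) (Or.inr ⟨hx, rfl⟩))).symm
    simp only [rep, this]
  -- `B'' = (B − B∘rep)/m`, an integer-valued `τ`-invariant function
  have hdvd : ∀ x, m ∣ B x - B (rep x) := fun x ↦ hBmod x (rep x) (hrep x)
  let B'' : X → ℤ := fun x ↦ (B x - B (rep x)) / m
  have hB''m : ∀ x, m * B'' x = B x - B (rep x) := fun x ↦ Int.mul_ediv_cancel' (hdvd x)
  have hB''τ : ∀ x, B'' (τ x) = B'' x := by
    intro x; simp only [B'', hB, hrep_τ]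
  -- `m (c − B'') = A + C + B∘rep`
  have hkey : ∀ x, m * (c x - B'' x) = A x + C x + B (rep x) := by
    intro x; rw [mul_sub, hB''m x, hrel x]; ring
  -- equal values at the two ends of a good edge
  have hgoodeq : ∀ x, good x → c (S x) - B'' (S x) = c x - B'' x := by
    intro x hx
    obtain ⟨g1, g2, g3⟩ := hx
    have hCx : C x = 0 := by
      by_contra h
      rcases hC x h with h' | h'
      · exact g1 h'
      · exact g2 h'
    have hCSx : C (S x) = 0 := by
      by_contra h
      rcases hC (S x) h with h' | h'
      · exact g1 (by rw [hS] at h'; exact h'.symm)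
      · exact g3 h'
    have e1 := hkey x
    have e2 := hkey (S x)
    rw [hA, hCSx, hrep_S x ⟨g1, g2, g3⟩] at e2
    rw [hCx] at e1
    have : m * (c (S x) - B'' (S x)) = m * (c x - B'' x) := by rw [e1, e2]
    exact mul_left_cancel₀ hm this
  -- (1) `Σ B''·M = 0` by the `τ`-orbit decomposition (no `3`-torsion hypothesis)
  have hsumB : ∑ x, B'' x • M x = 0 := sum_smul_eq_zero_of_tau_invariant τ hτ M hM₂ hM₄ B'' hB''τ
  -- (2) `Σ (c − B'')·M = 0` by the involution `S`
  have hsumS : ∑ x, (c x - B'' x) • M x = 0 := by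
    refine Finset.sum_involution (fun x _ ↦ S x) (fun x _ ↦ ?_) (fun x _ hne ↦ ?_) (fun x _ ↦ Finset.mem_univ _)
      (fun x _ ↦ hS x)
    · -- `f x + f (S x) = 0`
      by_cases hfix : S x = x
      · rw [hfix, hM₃ x hfix, smul_zero, add_zero]
      · by_cases hτx : τ x = x
        · rw [hM₁, hM₄ x hτx, neg_zero, smul_zero, smul_zero, add_zero]
        · by_cases hτS : τ (S x) = S x
          · have hMS : M (S x) = 0 := hM₄ (S x) hτS
            have hMx : M x = 0 := by
              have := hM₁ (S x); rw [hS, hMS, neg_zero] at this; exact this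
            rw [hMS, hMx, smul_zero, smul_zero, add_zero]
          · rw [hgoodeq x ⟨hfix, hτx, hτS⟩, hM₁, smul_neg, add_neg_cancel]
    · -- `f x ≠ 0 → S x ≠ x`
      intro hfix
      apply hne
      rw [hM₃ x hfix, smul_zero]
  -- assemble
  have e : ∑ x, c x • M x = ∑ x, (c x - B'' x) • M x + ∑ x, B'' x • M x := by
    rw [← Finset.sum_add_distrib]
    exact Finset.sum_congr rfl fun x _ ↦ by rw [← add_smul, sub_add_cancel]
  rw [e, hsumS, hsumB, add_zero]

end Torsion

/-! ## §2. `τ`-fixed cosets carry elliptic periods of order `3` -/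

section TauFixed

variable {R : Type*} [AddCommGroup R] {N : ℕ} {Φ : ℚ → R}

/-- **`τ`-fixed cosets carry elliptic periods** (the `τ`-analogue of the landed
`maninSymbol_eq_neg_maninCusp_of_sigmaFixed`): if `γ g = g τ` with `γ ∈ Γ₀(N)`, `τ = S T⁻¹ = (0,−1;1,−1)` (the coset
`Γ₀(N)g` is fixed by `τ`; `γ = gτg⁻¹` is elliptic of order `3` in `PSL₂`), then the Manin symbol of `Φ` at `g` is
`−Φ(γ·∞)`: indeed `gτ` and `gS` have the same first column, so `Φ̂(gS) = Φ̂(gτ) = Φ̂(γg) = Φ̂(γ) + Φ̂(g)` by the cocycle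
identity. [cite: Manin1972, §1.5–1.7] -/
theorem maninSymbol_eq_neg_maninCusp_of_tauFixed
    (hM : ∀ (γ : Gamma0 N) (r : ℚ), ((γ : SL(2, ℤ)) 1 0 : ℚ) * r + ((γ : SL(2, ℤ)) 1 1 : ℚ) ≠ 0 →
      Φ ((((γ : SL(2, ℤ)) 0 0 : ℚ) * r + ((γ : SL(2, ℤ)) 0 1 : ℚ)) /
        (((γ : SL(2, ℤ)) 1 0 : ℚ) * r + ((γ : SL(2, ℤ)) 1 1 : ℚ))) =
        (if ((γ : SL(2, ℤ)) 1 0) = 0 then 0 else Φ ((((γ : SL(2, ℤ)) 0 0 : ℚ)) / (((γ : SL(2, ℤ)) 1 0 : ℚ)))) + Φ r)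
    (γ : Gamma0 N) (g : SL(2, ℤ)) (hfix : (γ : SL(2, ℤ)) * g = g * (S * T⁻¹)) :
    (if (g 1 0) = 0 then 0 else Φ (((g 0 0 : ℚ)) / ((g 1 0 : ℚ)))) -
      (if ((g * S) 1 0) = 0 then 0
        else Φ ((((g * S) 0 0 : ℚ)) / (((g * S) 1 0 : ℚ)))) =
      -(if ((γ : SL(2, ℤ)) 1 0) = 0 then 0 else Φ ((((γ : SL(2, ℤ)) 0 0 : ℚ)) / (((γ : SL(2, ℤ)) 1 0 : ℚ)))) := by
  have h := maninCusp_gamma0_mul_sl hM γ g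
  rw [hfix] at h
  -- `g(S T⁻¹)` and `gS` have the same first column
  have e0 : (g * (S * T⁻¹)) 0 0 = (g * S) 0 0 := by
    rw [← mul_assoc, Matrix.SpecialLinearGroup.coe_mul (g * S) T⁻¹, coe_T_inv]
    simp [Matrix.mul_apply, Fin.sum_univ_two]
  have e1 : (g * (S * T⁻¹)) 1 0 = (g * S) 1 0 := by
    rw [← mul_assoc, Matrix.SpecialLinearGroup.coe_mul (g * S) T⁻¹, coe_T_inv]
    simp [Matrix.mul_apply, Fin.sum_univ_two]
  rw [e0, e1] at h
  rw [h]
  abel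

end TauFixed

end Summit.BirchSwinnertonDyer.BirchSwinnertonDyer.Theorems.TameQuarticManinParity

end
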